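import Summits.CriticalPhenomena.PercolationContinuityZ3.Theorems.SahiBoxTP2AffiliationConverse
import Summits.CriticalPhenomena.PercolationContinuityZ3.Theorems.SahiBoxTP2StrongFKGIff
import Summits.CriticalPhenomena.PercolationContinuityZ3.Theorems.SahiBoxTP2CellFKG
import Summits.CriticalPhenomena.PercolationContinuityZ3.Theorems.SahiBoxTP2PositiveAssociation
import Mathlib.Data.List.TFAE

/-!
# Box-TP₂ on the unit cube `Q_d`: the equivalent forms proved in the tree, as one `TFAE`

Support file of the Sahi cell (`prim-sahi`, typer seat, generation 16; `--supports stmt-CriticalPhenomena-4575`).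
Theorems only (no definitions, no named facts, no sorries).  One citable statement collecting the cell's density-free
total-positivity theory for a probability measure `μ` on `Q_d = [0,1]^d` (generations 11–15; each item is an existing
`iff`):

0. `IsBoxTP2 μ` — TP₂ on closed boxes: `μ[a,b] μ[a',b'] ≤ μ[a ∧ a', b ∧ b'] μ[a ∨ a', b ∨ b']`;
1. `mIsSetTP2 μ` — the density-free MTP₂ of Colangelo–Müller–Scarsini (TP₂ on all measurable sets,
   `isBoxTP2_iff_mIsSetTP2`);
2. `mIsAffiliated μ` — affiliation (Milgrom–Weber): every conditional law on a measurable sublattice is positively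
   associated (`isBoxTP2_iff_mIsAffiliated`, Müller–Stoyan Thm. 3.10.16 density-free);
3. MONOTONIC: boxes in the strong set order are stochastically ordered under conditioning
   (`isBoxTP2_iff_cond_Icc_mono_cube`, Grimmett's Thm. 2.27 density-free);
4. STRONGLY POSITIVELY ASSOCIATED: every law conditioned on a closed box of positive mass is positively associated
   (`isBoxTP2_iff_spa_cube`);
5. CELL-FKG: on every grid level the cell weights satisfy the FKG lattice condition
   (`isFKGMeasure_cubeCellWeight_iff_isBoxTP2`).
Consequences recorded alongside (`IsBoxTP2.consequences_cube`): positive association for all measurable increasing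
events and the existence of an a.e.-monotone Borel map `G` with `G_* λ = μ` (the coupling theorem
`exists_aemonotone_coupling`; the converse of the coupling statement is false, `KahnFUINotFKG`).

No sorries, no new axioms.
-/

noncomputable section

namespace Summit.CriticalPhenomena.PercolationContinuityZ3.Theorems.SahiBoxTP2

open MeasureTheory Set Function Literature.Probability.Percolation
open Literature.Probability.LatticeModels.Affiliation (mIsSetTP2 mIsAffiliated)
open scoped ENNReal unitInterval

variable {d : ℕ}

/-- **The equivalent forms of box-TP₂ for a probability measure on `Q_d`.** [this work] -/
theorem isBoxTP2_tfae_cube (μ : Measure (Fin d → I)) [IsProbabilityMeasure μ] :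
    List.TFAE
      [ IsBoxTP2 μ,
        mIsSetTP2 μ,
        mIsAffiliated μ,
        ∀ a₁ b₁ a₂ b₂ : Fin d → I, a₁ ≤ a₂ → b₁ ≤ b₂ → ∀ U : Set (Fin d → I), IsUpperSet U → MeasurableSet U →
          μ (U ∩ Icc a₁ b₁) * μ (Icc a₂ b₂) ≤ μ (Icc a₁ b₁) * μ (U ∩ Icc a₂ b₂),
        ∀ p q : Fin d → I, μ (Icc p q) ≠ 0 → IsPositivelyAssociated ((μ (Icc p q))⁻¹ • μ.restrict (Icc p q)),
        ∀ m, Literature.Combinatorics.Sahi2008.IsFKGMeasure (SahiCubeDensity.cubeCellWeight μ m) ] := by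
  tfae_have 1 ↔ 2 := isBoxTP2_iff_mIsSetTP2 μ
  tfae_have 1 ↔ 3 := isBoxTP2_iff_mIsAffiliated μ
  tfae_have 1 ↔ 4 := isBoxTP2_iff_cond_Icc_mono_cube μ
  tfae_have 1 ↔ 5 := isBoxTP2_iff_spa_cube μ
  tfae_have 6 ↔ 1 := isFKGMeasure_cubeCellWeight_iff_isBoxTP2 μ
  tfae_finish

/-- **Consequences of box-TP₂ on `Q_d`**: positive association (all measurable increasing events) and the
a.e.-monotone coupling to Lebesgue measure. [this work] -/
theorem IsBoxTP2.consequences_cube (μ : Measure (Fin d → I)) [IsProbabilityMeasure μ] (hμ : IsBoxTP2 μ) :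
    IsPositivelyAssociated μ ∧
      ∃ G : (Fin d → I) → (Fin d → I), ∃ S : Set (Fin d → I), Measurable G ∧
        (∀ᵐ x ∂(volume : Measure (Fin d → I)), x ∈ S) ∧ MonotoneOn G S ∧
        (volume : Measure (Fin d → I)).map G = μ :=
  ⟨hμ.isPositivelyAssociated_cube μ, exists_aemonotone_coupling d μ hμ⟩

end Summit.CriticalPhenomena.PercolationContinuityZ3.Theorems.SahiBoxTP2
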